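import Literature.NumberTheory.EllipticCurves.QuadraticTwistPointsOverSqrtField
import Literature.NumberTheory.EllipticCurves.SelmerGroupOverCoefficientTransport
import Literature.NumberTheory.EllipticCurves.IwasawaSelmer
import HarnessLib

/-!
# `Sel_{p^∞}(E^{(d)}/L) ≅ Sel_{p^∞}(E/L)` for `√d ∈ L = K̄^H` — the quadratic twist INSIDE a `ℤ_p`-tower
# (Greenberg LNM 1716 §4 p. 107 «`A_s = A` as `G_{F_∞}`-modules»; Rubin, *Euler Systems* VI §1–§2)

For a Weierstrass curve `W` over a number field `K`, `d ∈ K^×` and a square root `θ ∈ K̄` of `d`, the twist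
isomorphism `e_θ : W^{(d)}(K̄) ≃+ W(K̄)` (`twistGeomPointsEquiv`, file `QuadraticTwistPointsOverSqrtField`) satisfies
`e_θ(σP) = χ_θ(σ)·σ·e_θ(P)` with the QUADRATIC SIGN `χ_θ(σ) = ±1` according as `σθ = ±θ` (`quadraticSign`). For
every subgroup `H ≤ Γ_K` FIXING `θ` (i.e. `√d ∈ L = K̄^H` — inside a `ℤ_p`-extension `K_∞ = K̄^{ker κ}` this happens
exactly when `K(√d) ⊂ K_∞`, so non-trivially only for `p = 2`; over `ℚ`: `√2 ∈ ℚ_∞^{cyc}`), file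
`SelmerGroupOverCoefficientTransport` then gives `Ψ : H¹(H, W^{(d)}[p^∞]) ≃+ H¹(H, W[p^∞])` carrying
`Sel_{p^∞}(W^{(d)}/L)` onto `Sel_{p^∞}(W/L)` with `Ψ ∘ conj_σ = χ_θ(σ)·conj_σ ∘ Ψ`; the local isomorphisms at the
completions `K_v` are the SAME substitution at `θ_v = closureEmb θ ∈ K̄_v` (`twistLocalPointsEquiv`,
`pointsMapOfEmb_twistGeomPointsEquiv`).

* `quadraticSign θ σ ∈ {±1}`, `smul_sqrt_eq_or_eq_neg`, `twistGeomPointsEquiv_smul_quadraticSign`;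
* `smul_closureEmb_sqrt_of_mem`, `mem_localKerOver_iff_twist` — the local condition at every `K`-field;
* **`mem_selmerGroupOver_iff_twist`**, **`twistH1Equiv_conjH1`** — `Sel(W^{(d)}/L) ≅ Sel(W/L)` under
  `Ψ = twistH1Equiv`, and the sign rule;
* models: **`exists_subgroupH1_equiv_of_quadraticTwist_model`** — for ANY `K`-model `W₂` of `W^{(d)}`
  (`V • W₂ = W^{(d)}`) and any `ℤ_p`-extension `κ` with `√d ∈ K_∞`: `∃ Ψ : H¹(K_∞, W₂[p^∞]) ≃+ H¹(K_∞, W[p^∞])` with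
  `Ψ(Sel(W₂/K_∞)) = Sel(W/K_∞)` and `Ψ ∘ conj_σ = χ_θ(σ) · conj_σ ∘ Ψ` — the input `(Ψ, hΨ, hconj)` of
  `SelmerCharacterTwist.exists_charTwist_selmerDualData` (file `IwasawaSelmerCharacterTwistProofs`).

Two definitions with bodies (`quadraticSign`, `twistH1Equiv`) and theorems; no named fact, no instance, no `sorry`.

References: [GreenbergLNM1716] §4 pp. 105–107; [Rubin2000] Ch. VI §1–§2; [SilvermanAEC2009] X.2 Prop. 2.4, X.§4,
X.5 Cor. 5.4; [DokchitserDokchitserAnnals2010] Lemma 4.14.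
-/

noncomputable section

open scoped Classical

universe u

namespace Literature.NumberTheory.EllipticCurves

namespace QuadraticTwistSelmer

open WeierstrassCurve NumberField IsDedekindDomain CoeffTwist

/-! ## §1 The quadratic sign `χ_θ` -/

section Sign

variable {K : Type u} [Field K]

/-- The quadratic sign of `σ ∈ Γ_K` at a square root `θ ∈ K̄`: `+1` if `σθ = θ`, `−1` otherwise (for `θ² = d ∈ K^×`,
`char K ≠ 2`, this is the quadratic character of `K(√d)/K`). [cite: SilvermanAEC2009, X.2 Prop. 2.4] -/
def quadraticSign (θ : AlgebraicClosure K) (σ : Field.absoluteGaloisGroup K) : ℤ :=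
  if σ • θ = θ then 1 else -1

/-- `χ_θ(σ) = ±1`. [cite: SilvermanAEC2009, X.2 Prop. 2.4] -/
theorem quadraticSign_eq_one_or (θ : AlgebraicClosure K) (σ : Field.absoluteGaloisGroup K) :
    quadraticSign θ σ = 1 ∨ quadraticSign θ σ = -1 := by
  unfold quadraticSign; split_ifs <;> simp

/-- `χ_θ(σ) = 1` when `σθ = θ`. [cite: SilvermanAEC2009, X.2 Prop. 2.4] -/
theorem quadraticSign_of_smul_eq {θ : AlgebraicClosure K} {σ : Field.absoluteGaloisGroup K} (h : σ • θ = θ) :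
    quadraticSign θ σ = 1 := if_pos h

/-- `χ_θ(σ) = −1` when `σθ = −θ` and `θ ≠ 0`, `char ≠ 2`. [cite: SilvermanAEC2009, X.2 Prop. 2.4] -/
theorem quadraticSign_of_smul_eq_neg [NeZero (2 : K)] {θ : AlgebraicClosure K} (hθ0 : θ ≠ 0)
    {σ : Field.absoluteGaloisGroup K} (h : σ • θ = -θ) : quadraticSign θ σ = -1 := by
  have h2 : (2 : AlgebraicClosure K) ≠ 0 := by
    rw [← map_ofNat (algebraMap K (AlgebraicClosure K)) 2, map_ne_zero]
    exact two_ne_zero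
  unfold quadraticSign
  rw [if_neg]
  intro h'
  rw [h'] at h
  have : (2 : AlgebraicClosure K) * θ = 0 := by linear_combination h
  exact hθ0 ((mul_eq_zero.mp this).resolve_left h2)

variable {d : K} (hd : d ≠ 0) {θ : AlgebraicClosure K} (hθ : θ ^ 2 = algebraMap K (AlgebraicClosure K) d)

include hθ in
/-- `σθ = ±θ` for every `σ ∈ Γ_K` (both are square roots of `d ∈ K`). [cite: SilvermanAEC2009, X.2 Prop. 2.4] -/
theorem smul_sqrt_eq_or_eq_neg (σ : Field.absoluteGaloisGroup K) : σ • θ = θ ∨ σ • θ = -θ := by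
  apply sq_eq_sq_iff_eq_or_eq_neg.mp
  change ((show AlgebraicClosure K ≃ₐ[K] AlgebraicClosure K from σ) θ) ^ 2 = θ ^ 2
  rw [← map_pow, hθ, AlgEquiv.commutes]

variable [NeZero (2 : K)] (W : WeierstrassCurve K) {C : VariableChange K} (hC : C • W = W.quadraticTwist 1)

include hθ in
/-- **`e_θ(σP) = χ_θ(σ)·σ·e_θ(P)`**: the twist isomorphism is Galois-equivariant up to the quadratic sign (Silverman X.2
Prop. 2.4: `E^{(d)}(K̄) = E(K̄) ⊗ χ`). [cite: SilvermanAEC2009, X.2 Prop. 2.4] -/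
theorem twistGeomPointsEquiv_smul_quadraticSign (σ : Field.absoluteGaloisGroup K) (P : (W.quadraticTwist d).geomPoints) :
    twistGeomPointsEquiv W hC hd hθ (σ • P) = quadraticSign θ σ • σ • twistGeomPointsEquiv W hC hd hθ P := by
  rcases smul_sqrt_eq_or_eq_neg hθ σ with h | h
  · rw [quadraticSign_of_smul_eq h, one_zsmul, twistGeomPointsEquiv_smul_of_eq W hC hd hθ σ h]
  · rw [quadraticSign_of_smul_eq_neg (sqrt_ne_zero_of_sq_eq hd hθ) h, neg_one_zsmul,
      twistGeomPointsEquiv_smul_of_eq_neg W hC hd hθ σ h]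

end Sign

/-! ## §2 The local condition: the same substitution at `θ_v = closureEmb θ ∈ K̄_v` -/

section Local

variable {K : Type u} [Field K] [NeZero (2 : K)] (W : WeierstrassCurve K) {C : VariableChange K}
  (hC : C • W = W.quadraticTwist 1) {d : K} (hd : d ≠ 0) {θ : AlgebraicClosure K}
  (hθ : θ ^ 2 = algebraMap K (AlgebraicClosure K) d) (p : ℕ) (H : Subgroup (Field.absoluteGaloisGroup K))
  (hH : ∀ σ : Field.absoluteGaloisGroup K, σ ∈ H → σ • θ = θ)
  (E : Type u) [Field E] [Algebra K E]

include hH in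
omit [NeZero (2 : K)] in
/-- `χ_θ|_H = 1` when `H` fixes `θ`. [cite: GreenbergLNM1716, §4 p. 107] -/
theorem quadraticSign_of_mem (σ : Field.absoluteGaloisGroup K) (hσ : σ ∈ H) : quadraticSign θ σ = 1 :=
  quadraticSign_of_smul_eq (hH σ hσ)

include hθ in
omit [NeZero (2 : K)] in
/-- `θ_E = closureEmb θ` is a square root of `d` in `K̄_E` (the chosen embedding `K̄ → K̄_E` is a `K`-algebra map).
[cite: SerreGaloisCohomology1997, II §1.1] -/
theorem closureEmb_sqrt_sq : (closureEmb (K := K) E θ) ^ 2 = algebraMap K (AlgebraicClosure E) d := by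
  rw [← map_pow, hθ, AlgHom.commutes]

include hH in
omit [NeZero (2 : K)] in
/-- A `τ ∈ Γ_E` restricting into `H` fixes `θ_E = closureEmb θ` (`closureEmb ∘ res τ = τ ∘ closureEmb`).
[cite: SerreGaloisCohomology1997, II §1.1] -/
theorem smul_closureEmb_sqrt_of_mem (τ : Field.absoluteGaloisGroup E) (hτ : resGal (K := K) E τ ∈ H) :
    τ • closureEmb (K := K) E θ = closureEmb (K := K) E θ := by
  have h := apply_resGalAuxOfEmb_apply (closureEmb (K := K) E) τ θ
  change closureEmb (K := K) E (resGal (K := K) E τ • θ) = τ • closureEmb (K := K) E θ at h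
  rw [hH _ hτ] at h
  exact h.symm

/-- **The local Selmer condition at `E` corresponds under `Ψ_θ`** (the substitution at `θ_E = closureEmb θ` on `E(K̄_E)`
is `H_E`-equivariant and compatible with `pointsMap`). [cite: SilvermanAEC2009, X.§4] -/
theorem mem_localKerOver_iff_twist (x : (W.quadraticTwist d).subgroupH1 p H) :
    x ∈ (W.quadraticTwist d).localKerOver p H E ↔
      coeffH1Equiv p H (twistGeomPointsEquiv W hC hd hθ) (quadraticSign θ)
        (twistGeomPointsEquiv_smul_quadraticSign hd hθ W hC) (quadraticSign_of_mem H hH) x ∈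
        W.localKerOver p H E :=
  mem_localKerOver_iff_coeffH1Equiv_mem p H _ _ _ _ E
    (twistLocalPointsEquiv W hC hd E (closureEmb_sqrt_sq hθ E))
    (fun τ hτ Q ↦ twistLocalPointsEquiv_smul_of_eq W hC hd (closureEmb_sqrt_sq hθ E) τ
      (smul_closureEmb_sqrt_of_mem H hH E τ hτ) Q)
    (fun P ↦ pointsMapOfEmb_twistGeomPointsEquiv W hC hd hθ (closureEmb (K := K) E) (closureEmb_sqrt_sq hθ E)
      rfl P) x

end Local

/-! ## §3 `Sel_{p^∞}(W^{(d)}/L) ≅ Sel_{p^∞}(W/L)` for `√d ∈ L = K̄^H` -/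

section Selmer

variable {K : Type u} [Field K] [NumberField K] (W : WeierstrassCurve K) {C : VariableChange K}
  (hC : C • W = W.quadraticTwist 1) {d : K} (hd : d ≠ 0) {θ : AlgebraicClosure K}
  (hθ : θ ^ 2 = algebraMap K (AlgebraicClosure K) d) (p : ℕ) (H : Subgroup (Field.absoluteGaloisGroup K)) [H.Normal]
  (hH : ∀ σ : Field.absoluteGaloisGroup K, σ ∈ H → σ • θ = θ)

/-- **`Ψ_θ : H¹(H, W^{(d)}[p^∞]) ≃+ H¹(H, W[p^∞])`** — the transport of `H¹` along the twist isomorphism `e_θ` (`H`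
fixing `θ`): `coeffH1Equiv` of file `SelmerGroupOverCoefficientTransport` at `(e_θ, χ_θ)`. Greenberg: `H¹(F_∞, A_s) =
H¹(F_∞, A)`. [cite: GreenbergLNM1716, §4 p. 107] -/
def twistH1Equiv : (W.quadraticTwist d).subgroupH1 p H ≃+ W.subgroupH1 p H :=
  coeffH1Equiv p H (twistGeomPointsEquiv W hC hd hθ) (quadraticSign θ)
    (twistGeomPointsEquiv_smul_quadraticSign hd hθ W hC) (quadraticSign_of_mem H hH)

/-- **`Sel_{p^∞}(W^{(d)}/L) ≅ Sel_{p^∞}(W/L)` under `Ψ_θ`** (`L = K̄^H ∋ √d`): Greenberg's «`Sel_E(F_∞)_p` for `A_s`»;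
Rubin VI §1–§2 (twisting by characters of `Gal(K_∞/K)`). [cite: GreenbergLNM1716, §4 p. 107] [cite: Rubin2000, Ch. VI §1–§2] -/
theorem mem_selmerGroupOver_iff_twist (x : (W.quadraticTwist d).subgroupH1 p H) :
    x ∈ (W.quadraticTwist d).selmerGroupOver p H ↔ twistH1Equiv W hC hd hθ p H hH x ∈ W.selmerGroupOver p H :=
  mem_selmerGroupOver_iff_coeffH1Equiv_mem p H _ _ _ _ (quadraticSign_eq_one_or θ)
    (fun v y ↦ mem_localKerOver_iff_twist W hC hd hθ p H hH (v.adicCompletion K) y)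
    (fun w y ↦ mem_localKerOver_iff_twist W hC hd hθ p H hH w.Completion y) x

/-- **The sign rule `Ψ_θ ∘ conj_σ = χ_θ(σ) · conj_σ ∘ Ψ_θ`** (`σ ∈ Γ_K`). [cite: GreenbergLNM1716, §4 p. 107] -/
theorem twistH1Equiv_conjH1 (σ : Field.absoluteGaloisGroup K) (x : (W.quadraticTwist d).subgroupH1 p H) :
    twistH1Equiv W hC hd hθ p H hH ((W.quadraticTwist d).conjH1 p H σ x) =
      quadraticSign θ σ • W.conjH1 p H σ (twistH1Equiv W hC hd hθ p H hH x) :=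
  coeffH1Equiv_conjH1 p H _ _ _ _ σ x

end Selmer

/-! ## §4 Models: any `K`-model `W₂` of `W^{(d)}`, over a `ℤ_p`-extension with `√d ∈ K_∞` -/

section Model

variable {K : Type u} [Field K] [NumberField K] {p : ℕ} [Fact p.Prime] (κ : ZpExtension K p)
  (W W₂ : WeierstrassCurve K) {d : K} (hd : d ≠ 0) {V : VariableChange K} (hV : V • W₂ = W.quadraticTwist d)
  {θ : AlgebraicClosure K} (hθ : θ ^ 2 = algebraMap K (AlgebraicClosure K) d)
  (hθker : ∀ σ : Field.absoluteGaloisGroup K, σ ∈ κ.kerSubgroup → σ • θ = θ)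

include hd hV hθ hθker in
/-- **The input of the character twist of `SelmerDualData`.** For ANY `K`-model `W₂` of `W^{(d)}` (`V • W₂ = W^{(d)}`)
and any `ℤ_p`-extension `κ` with `√d ∈ K_∞` (`ker κ` fixes `θ`): there is `Ψ : H¹(K_∞, W₂[p^∞]) ≃+ H¹(K_∞, W[p^∞])`
carrying `Sel_{p^∞}(W₂/K_∞)` onto `Sel_{p^∞}(W/K_∞)` with `Ψ ∘ conj_σ = χ_θ(σ)·conj_σ ∘ Ψ` for every `σ ∈ Γ_K` — the
composite of the `K`-isomorphism `W₂ ≅ W^{(d)}` (`χ = 1`, `mem_selmerGroupOver_iff_of_variableChange`) and `Ψ_θ`. This is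
EXACTLY the datum `(Ψ, hΨ, hconj)` consumed by `SelmerCharacterTwist.exists_charTwist_selmerDualData` (with
`c = χ_θ(γ)`). [cite: GreenbergLNM1716, §4 p. 107] [cite: Rubin2000, Ch. VI §1–§2] -/
theorem exists_subgroupH1_equiv_of_quadraticTwist_model :
    ∃ Ψ : W₂.subgroupH1 p κ.kerSubgroup ≃+ W.subgroupH1 p κ.kerSubgroup,
      (∀ s', Ψ s' ∈ W.selmerInfty κ ↔ s' ∈ W₂.selmerInfty κ) ∧
      ∀ (σ : Field.absoluteGaloisGroup K) (s' : W₂.subgroupH1 p κ.kerSubgroup),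
        Ψ (W₂.conjH1 p κ.kerSubgroup σ s') = quadraticSign θ σ • W.conjH1 p κ.kerSubgroup σ (Ψ s') := by
  obtain ⟨C, hC⟩ := W.exists_variableChange_quadraticTwist_one
  -- step 1 (`χ = 1`): `W₂ ≅ V • W₂ = W^{(d)}`
  let Ψ₁ : W₂.subgroupH1 p κ.kerSubgroup ≃+ (W.quadraticTwist d).subgroupH1 p κ.kerSubgroup :=
    coeffH1Equiv p κ.kerSubgroup (twistPointsIso hV) (fun _ ↦ 1) (twistPointsIso_smul_one hV) (fun _ _ ↦ rfl)
  -- step 2: `Ψ_θ`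
  let Ψ₂ : (W.quadraticTwist d).subgroupH1 p κ.kerSubgroup ≃+ W.subgroupH1 p κ.kerSubgroup :=
    twistH1Equiv W hC hd hθ p κ.kerSubgroup hθker
  refine ⟨Ψ₁.trans Ψ₂, fun s' ↦ ?_, fun σ s' ↦ ?_⟩
  · change Ψ₂ (Ψ₁ s') ∈ W.selmerGroupOver p κ.kerSubgroup ↔ s' ∈ W₂.selmerGroupOver p κ.kerSubgroup
    rw [mem_selmerGroupOver_iff_of_variableChange hV p κ.kerSubgroup s']
    exact (mem_selmerGroupOver_iff_twist W hC hd hθ p κ.kerSubgroup hθker (Ψ₁ s')).symm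
  · change Ψ₂ (Ψ₁ (W₂.conjH1 p κ.kerSubgroup σ s')) = quadraticSign θ σ • W.conjH1 p κ.kerSubgroup σ (Ψ₂ (Ψ₁ s'))
    have h1 : Ψ₁ (W₂.conjH1 p κ.kerSubgroup σ s') = (W.quadraticTwist d).conjH1 p κ.kerSubgroup σ (Ψ₁ s') := by
      have h := coeffH1Equiv_conjH1 p κ.kerSubgroup (twistPointsIso hV) (fun _ ↦ 1) (twistPointsIso_smul_one hV)
        (fun _ _ ↦ rfl) σ s'
      rw [one_zsmul] at h
      exact h
    rw [h1]
    exact twistH1Equiv_conjH1 W hC hd hθ p κ.kerSubgroup hθker σ (Ψ₁ s')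

end Model

end QuadraticTwistSelmer

end Literature.NumberTheory.EllipticCurves

end
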